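import Mathlib

/-!
# Template lattices are split — Aux file 2: the 2-adic obstruction and Gram–Schmidt steps
# (crux `HcpDiffractionRigidity`, item `stmt-AtomisticToContinuum-13166`,
# stub `stub_templateLatticeSplit`, B2c₁ᵦ)

In-layer squared template lengths of the hcp template are `a² (I² + IJ + J²)/9`, and Loeschian
numbers `I² + IJ + J² ≠ 0` are `4ᵏ · odd`.  A positive diagonal ternary rational form always takes
a value NOT of the form `4ᵏ · odd / odd` (pigeonhole on the odd parts modulo `4`).  Consequently
(`HcpRigiditySplit.no_three_orthogonal`) a symmetric biadditive `ℚ`-form all of whose diagonal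
values are `(I² + IJ + J²)/9` admits no three pairwise orthogonal vectors of positive "length":
this is what forces the in-layer part of a template lattice to have rank `2` and the interlayer
vector to be purely vertical.  The integral Gram–Schmidt steps `gramSchmidt_one/two` produce the
orthogonal vectors inside the lattice.

Registered helper stub: `stub_templateLatticeSplit_twoAdic`.  All `[folklore]`.
-/

noncomputable section

namespace Summit.AtomisticToContinuum.Crystallization.Theorems

namespace HcpRigiditySplit

/-! ## The 2-adic obstruction -/

/-- `2ᵃ u = 2ᵇ v` with `u, v` odd forces `a = b`. [folklore] -/
theorem two_pow_mul_odd_inj {a b : ℕ} {u v : ℤ} (hu : Odd u) (hv : Odd v)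
    (h : 2 ^ a * u = 2 ^ b * v) : a = b := by
  wlog hab : a ≤ b generalizing a b u v
  · exact (this hv hu h.symm (le_of_not_ge hab)).symm
  obtain ⟨c, rfl⟩ := Nat.exists_eq_add_of_le hab
  rw [pow_add, mul_assoc] at h
  have h2 : u = 2 ^ c * v := mul_left_cancel₀ (pow_ne_zero a two_ne_zero) h
  rcases Nat.eq_zero_or_pos c with hc | hc
  · omega
  · exfalso
    have : Even u := by
      rw [h2]
      exact (Int.even_pow.2 ⟨even_two, hc.ne'⟩).mul_right v
    exact (Int.not_even_iff_odd.2 hu) this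

/-- **Loeschian numbers have even 2-adic valuation**: `I² + IJ + J² = 4ᵏ u` with `u` odd, for
`(I, J) ≠ (0, 0)`. [folklore] -/
theorem loeschian_eq_four_pow_mul_odd (I J : ℤ) (h : I ≠ 0 ∨ J ≠ 0) :
    ∃ (k : ℕ) (u : ℤ), Odd u ∧ I ^ 2 + I * J + J ^ 2 = 4 ^ k * u := by
  set g := Int.gcd I J with hg
  have hg0 : g ≠ 0 := by
    rw [hg, Ne, Int.gcd_eq_zero_iff]; tauto
  obtain ⟨e, g', hg'odd, hge⟩ := Nat.exists_eq_two_pow_mul_odd hg0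
  obtain ⟨I₀, hI⟩ : (g : ℤ) ∣ I := Int.gcd_dvd_left I J
  obtain ⟨J₀, hJ⟩ : (g : ℤ) ∣ J := Int.gcd_dvd_right I J
  have hcop : ¬ (Even I₀ ∧ Even J₀) := by
    rintro ⟨⟨i, hi⟩, ⟨j, hj⟩⟩
    have h1 : ((2 * g : ℕ) : ℤ) ∣ I := ⟨i, by rw [hI, hi]; push_cast; ring⟩
    have h2 : ((2 * g : ℕ) : ℤ) ∣ J := ⟨j, by rw [hJ, hj]; push_cast; ring⟩
    have h3 : ((2 * g : ℕ) : ℤ) ∣ (g : ℤ) := by rw [hg]; exact Int.dvd_coe_gcd h1 h2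
    have h4 : 2 * g ∣ g := Int.natCast_dvd_natCast.1 h3
    have : 2 * g ≤ g := Nat.le_of_dvd (Nat.pos_of_ne_zero hg0) h4
    omega
  have hodd : Odd (I₀ ^ 2 + I₀ * J₀ + J₀ ^ 2) := by
    rcases Int.even_or_odd I₀ with ⟨i, hi⟩ | ⟨i, hi⟩ <;>
      rcases Int.even_or_odd J₀ with ⟨j, hj⟩ | ⟨j, hj⟩
    · exact absurd ⟨⟨i, hi⟩, ⟨j, hj⟩⟩ hcop
    · exact ⟨2 * i ^ 2 + i * (2 * j + 1) + 2 * j ^ 2 + 2 * j, by rw [hi, hj]; ring⟩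
    · exact ⟨2 * i ^ 2 + 2 * i + (2 * i + 1) * j + 2 * j ^ 2, by rw [hi, hj]; ring⟩
    · exact ⟨2 * i ^ 2 + 2 * i + 2 * i * j + i + j + 2 * j ^ 2 + 2 * j + 1, by rw [hi, hj]; ring⟩
  refine ⟨e, (g' : ℤ) ^ 2 * (I₀ ^ 2 + I₀ * J₀ + J₀ ^ 2), ?_, ?_⟩
  · exact ((Int.odd_coe_nat g').2 hg'odd).pow.mul hodd
  · rw [hI, hJ, hge, show (4 : ℤ) = 2 ^ 2 by norm_num, ← pow_mul]
    push_cast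
    ring

/-- A positive rational is `2ˢ n / (2ᵗ d)` with `n, d` odd. [folklore] -/
theorem exists_two_pow_odd_div {q : ℚ} (hq : 0 < q) :
    ∃ (s t : ℕ) (n d : ℤ), Odd n ∧ Odd d ∧ d ≠ 0 ∧ q = 2 ^ s * (n : ℚ) / (2 ^ t * d) := by
  have hnumpos : 0 < q.num := Rat.num_pos.2 hq
  have hnum : q.num.natAbs ≠ 0 := Int.natAbs_ne_zero.2 hnumpos.ne'
  obtain ⟨s, n, hn, hsn⟩ := Nat.exists_eq_two_pow_mul_odd hnum
  obtain ⟨t, d, hd, htd⟩ := Nat.exists_eq_two_pow_mul_odd q.den_nz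
  refine ⟨s, t, n, d, (Int.odd_coe_nat n).2 hn, (Int.odd_coe_nat d).2 hd,
    by exact_mod_cast hd.pos.ne', ?_⟩
  have h1 : ((q.num : ℤ) : ℚ) = 2 ^ s * (n : ℤ) := by
    have h2 : ((q.num.natAbs : ℕ) : ℚ) = ((2 ^ s * n : ℕ) : ℚ) := by rw [hsn]
    rw [Nat.cast_natAbs, Int.cast_abs, abs_of_pos (by exact_mod_cast hnumpos)] at h2
    rw [h2]; push_cast; ring
  have h2 : ((q.den : ℕ) : ℚ) = 2 ^ t * (d : ℤ) := by rw [htd]; push_cast; ring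
  calc q = q.num / q.den := (Rat.num_div_den q).symm
    _ = _ := by rw [h1, h2]

/-- One term: `2ˢ n / (2ᵗ d) = 4ᵏ u / v` with `n, d, u, v` odd forces `s + t` even. [folklore] -/
theorem even_add_of_eq_four_pow {s t k : ℕ} {n d u v : ℤ} (hn : Odd n) (hd : Odd d) (hu : Odd u)
    (hv : Odd v) (hd0 : (d : ℚ) ≠ 0) (hv0 : (v : ℚ) ≠ 0)
    (h : (2 : ℚ) ^ s * n / (2 ^ t * d) = 4 ^ k * u / v) : Even (s + t) := by
  have h1 : ((2 ^ s * (n * v) : ℤ) : ℚ) = ((2 ^ (2 * k + t) * (u * d) : ℤ) : ℚ) := by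
    push_cast
    rw [pow_add, pow_mul]
    field_simp at h
    linear_combination h
  have h2 := two_pow_mul_odd_inj (hn.mul hv) (hu.mul hd) (by exact_mod_cast h1)
  exact ⟨k + t, by omega⟩

/-- Mod-4 bookkeeping for the pigeonhole: if `n d ≡ n' d' (mod 4)` (all odd) then
`n d' + n' d = 2 w` with `w` odd. [folklore] -/
theorem exists_odd_half {n d n' d' : ℤ} (hn : Odd n) (hd : Odd d) (hn' : Odd n') (hd' : Odd d')
    (hmod : n * d % 4 = n' * d' % 4) : ∃ w : ℤ, Odd w ∧ n * d' + n' * d = 2 * w := by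
  obtain ⟨a, rfl⟩ := hn
  obtain ⟨b, rfl⟩ := hd
  obtain ⟨a', rfl⟩ := hn'
  obtain ⟨b', rfl⟩ := hd'
  refine ⟨2 * (a * b') + 2 * (a' * b) + (a + b' + a' + b) + 1, ?_, by ring⟩
  have e1 : (2 * a + 1) * (2 * b + 1) = 4 * (a * b) + 2 * (a + b) + 1 := by ring
  have e2 : (2 * a' + 1) * (2 * b' + 1) = 4 * (a' * b') + 2 * (a' + b') + 1 := by ring
  rw [e1, e2] at hmod
  rw [Int.odd_iff]
  generalize a * b = P at *
  generalize a' * b' = P' at *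
  generalize a * b' = Q at *
  generalize a' * b = Q' at *
  omega

/-- Two terms: with `sᵢ + tᵢ`, `sⱼ + tⱼ` even and `nᵢ dᵢ ≡ nⱼ dⱼ (mod 4)`, suitable powers of two
`x = 2^X`, `y = 2^Y` give `qᵢ x² + qⱼ y²` of odd 2-adic valuation, hence not of the form
`4ᵏ u / v` with `u, v` odd. [folklore] -/
theorem exists_pair_ne_four_pow {sᵢ tᵢ sⱼ tⱼ : ℕ} {nᵢ dᵢ nⱼ dⱼ : ℤ} (hni : Odd nᵢ) (hdi : Odd dᵢ)
    (hnj : Odd nⱼ) (hdj : Odd dⱼ) (hei : Even (sᵢ + tᵢ)) (hej : Even (sⱼ + tⱼ))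
    (hmod : nᵢ * dᵢ % 4 = nⱼ * dⱼ % 4) :
    ∃ X Y : ℕ, ∀ (k : ℕ) (u v : ℤ), Odd u → Odd v → (v : ℚ) ≠ 0 →
      (2 : ℚ) ^ sᵢ * nᵢ / (2 ^ tᵢ * dᵢ) * (2 ^ X) ^ 2 +
        (2 : ℚ) ^ sⱼ * nⱼ / (2 ^ tⱼ * dⱼ) * (2 ^ Y) ^ 2 ≠ 4 ^ k * u / v := by
  obtain ⟨w, hw, hw2⟩ := exists_odd_half hni hdi hnj hdj hmod
  have hdi0 : (dᵢ : ℚ) ≠ 0 := by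
    have := Int.odd_iff.1 hdi
    exact_mod_cast show dᵢ ≠ 0 by omega
  have hdj0 : (dⱼ : ℚ) ≠ 0 := by
    have := Int.odd_iff.1 hdj
    exact_mod_cast show dⱼ ≠ 0 by omega
  -- it suffices to balance the exponents
  suffices key : ∀ X Y : ℕ, sᵢ + 2 * X + tⱼ = sⱼ + 2 * Y + tᵢ →
      ∀ (k : ℕ) (u v : ℤ), Odd u → Odd v → (v : ℚ) ≠ 0 →
        (2 : ℚ) ^ sᵢ * nᵢ / (2 ^ tᵢ * dᵢ) * (2 ^ X) ^ 2 +
          (2 : ℚ) ^ sⱼ * nⱼ / (2 ^ tⱼ * dⱼ) * (2 ^ Y) ^ 2 ≠ 4 ^ k * u / v by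
    obtain ⟨r, hr⟩ := hei
    obtain ⟨r', hr'⟩ := hej
    rcases le_total (sᵢ + tⱼ) (sⱼ + tᵢ) with hle | hle
    · exact ⟨(sⱼ + tᵢ - (sᵢ + tⱼ)) / 2, 0, key _ _ (by omega)⟩
    · exact ⟨0, (sᵢ + tⱼ - (sⱼ + tᵢ)) / 2, key _ _ (by omega)⟩
  intro X Y hE k u v hu hv hv0 heq
  obtain ⟨E, hE1⟩ : ∃ E : ℕ, E = sᵢ + 2 * X + tⱼ := ⟨_, rfl⟩
  have hE2 : E = tᵢ + sⱼ + 2 * Y := by omega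
  have h2i : (2 : ℚ) ^ tᵢ ≠ 0 := pow_ne_zero _ two_ne_zero
  have h2j : (2 : ℚ) ^ tⱼ ≠ 0 := pow_ne_zero _ two_ne_zero
  have hx : ((2 : ℚ) ^ X) ^ 2 = 4 ^ X := by rw [← pow_mul, mul_comm, pow_mul]; norm_num
  have hy : ((2 : ℚ) ^ Y) ^ 2 = 4 ^ Y := by rw [← pow_mul, mul_comm, pow_mul]; norm_num
  rw [hx, hy] at heq
  -- clear denominators
  have h2 : ((2 ^ sᵢ * nᵢ * 4 ^ X * 2 ^ tⱼ * dⱼ + 2 ^ tᵢ * dᵢ * 2 ^ sⱼ * nⱼ * 4 ^ Y) * v : ℤ) =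
      ((4 ^ k * u * (2 ^ tᵢ * dᵢ) * (2 ^ tⱼ * dⱼ) : ℤ) : ℚ) := by
    push_cast
    field_simp at heq
    linear_combination heq
  have h2' : (2 ^ sᵢ * nᵢ * 4 ^ X * 2 ^ tⱼ * dⱼ + 2 ^ tᵢ * dᵢ * 2 ^ sⱼ * nⱼ * 4 ^ Y) * v =
      (4 : ℤ) ^ k * u * (2 ^ tᵢ * dᵢ) * (2 ^ tⱼ * dⱼ) := by exact_mod_cast h2
  have h4 : (2 : ℤ) ^ sᵢ * 4 ^ X * 2 ^ tⱼ = 2 ^ E := by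
    rw [hE1, show (4 : ℤ) = 2 ^ 2 by norm_num, ← pow_mul, ← pow_add, ← pow_add]
  have h5 : (2 : ℤ) ^ tᵢ * 2 ^ sⱼ * 4 ^ Y = 2 ^ E := by
    rw [hE2, show (4 : ℤ) = 2 ^ 2 by norm_num, ← pow_mul, ← pow_add, ← pow_add]
  have h6 : (2 : ℤ) ^ (E + 1) * (w * v) = 2 ^ (2 * k + tᵢ + tⱼ) * (u * dᵢ * dⱼ) := by
    rw [pow_succ, pow_add, pow_add, pow_mul, show (2 : ℤ) ^ 2 = 4 by norm_num]
    linear_combination h2' - (nᵢ * dⱼ * v) * h4 - (dᵢ * nⱼ * v) * h5 - (2 ^ E * v) * hw2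
  have h7 := two_pow_mul_odd_inj (hw.mul hv) ((hu.mul hdi).mul hdj) h6
  obtain ⟨r, hr⟩ := hei
  omega

/-- **The 2-adic obstruction.** A diagonal ternary form with positive rational coefficients takes,
at some non-zero integer point, a value which is not of the form `4ᵏ u / v` with `u, v` odd
(pigeonhole on the residues `nᵢ dᵢ mod 4` of the odd parts). In particular no positive definite
rational ternary form takes only in-layer template values `(I² + IJ + J²)/9`
(`loeschian_eq_four_pow_mul_odd`). [folklore] -/
theorem exists_ne_four_pow_mul_odd_div {q₁ q₂ q₃ : ℚ} (h₁ : 0 < q₁) (h₂ : 0 < q₂) (h₃ : 0 < q₃) :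
    ∃ x y z : ℤ, (x ≠ 0 ∨ y ≠ 0 ∨ z ≠ 0) ∧ ∀ (k : ℕ) (u v : ℤ), Odd u → Odd v → v ≠ 0 →
      q₁ * (x : ℚ) ^ 2 + q₂ * (y : ℚ) ^ 2 + q₃ * (z : ℚ) ^ 2 ≠ 4 ^ k * u / v := by
  obtain ⟨s₁, t₁, n₁, d₁, hn₁, hd₁, hd₁0, rfl⟩ := exists_two_pow_odd_div h₁
  obtain ⟨s₂, t₂, n₂, d₂, hn₂, hd₂, hd₂0, rfl⟩ := exists_two_pow_odd_div h₂
  obtain ⟨s₃, t₃, n₃, d₃, hn₃, hd₃, hd₃0, rfl⟩ := exists_two_pow_odd_div h₃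
  have hd₁' : (d₁ : ℚ) ≠ 0 := by exact_mod_cast hd₁0
  have hd₂' : (d₂ : ℚ) ≠ 0 := by exact_mod_cast hd₂0
  have hd₃' : (d₃ : ℚ) ≠ 0 := by exact_mod_cast hd₃0
  -- a coefficient of odd valuation: take a unit vector
  by_cases he₁ : Even (s₁ + t₁)
  swap
  · refine ⟨1, 0, 0, by norm_num, fun k u v hu hv hv0 heq => he₁ ?_⟩
    refine even_add_of_eq_four_pow (k := k) hn₁ hd₁ hu hv hd₁' (by exact_mod_cast hv0) ?_
    rw [← heq]; push_cast; ring
  by_cases he₂ : Even (s₂ + t₂)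
  swap
  · refine ⟨0, 1, 0, by norm_num, fun k u v hu hv hv0 heq => he₂ ?_⟩
    refine even_add_of_eq_four_pow (k := k) hn₂ hd₂ hu hv hd₂' (by exact_mod_cast hv0) ?_
    rw [← heq]; push_cast; ring
  by_cases he₃ : Even (s₃ + t₃)
  swap
  · refine ⟨0, 0, 1, by norm_num, fun k u v hu hv hv0 heq => he₃ ?_⟩
    refine even_add_of_eq_four_pow (k := k) hn₃ hd₃ hu hv hd₃' (by exact_mod_cast hv0) ?_
    rw [← heq]; push_cast; ring
  -- all valuations even: pigeonhole on `nᵢ dᵢ mod 4`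
  have hp : n₁ * d₁ % 4 = n₂ * d₂ % 4 ∨ n₁ * d₁ % 4 = n₃ * d₃ % 4 ∨ n₂ * d₂ % 4 = n₃ * d₃ % 4 := by
    have o₁ := Int.odd_iff.1 (hn₁.mul hd₁)
    have o₂ := Int.odd_iff.1 (hn₂.mul hd₂)
    have o₃ := Int.odd_iff.1 (hn₃.mul hd₃)
    generalize n₁ * d₁ = p₁ at *
    generalize n₂ * d₂ = p₂ at *
    generalize n₃ * d₃ = p₃ at *
    omega
  have h20 : ∀ X : ℕ, ((2 : ℤ) ^ X : ℤ) ≠ 0 := fun X => pow_ne_zero _ two_ne_zero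
  rcases hp with hp | hp | hp
  · obtain ⟨X, Y, hXY⟩ := exists_pair_ne_four_pow hn₁ hd₁ hn₂ hd₂ he₁ he₂ hp
    refine ⟨2 ^ X, 2 ^ Y, 0, Or.inl (h20 X), fun k u v hu hv hv0 heq => ?_⟩
    refine hXY k u v hu hv (by exact_mod_cast hv0) ?_
    rw [← heq]; push_cast; ring
  · obtain ⟨X, Y, hXY⟩ := exists_pair_ne_four_pow hn₁ hd₁ hn₃ hd₃ he₁ he₃ hp
    refine ⟨2 ^ X, 0, 2 ^ Y, Or.inl (h20 X), fun k u v hu hv hv0 heq => ?_⟩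
    refine hXY k u v hu hv (by exact_mod_cast hv0) ?_
    rw [← heq]; push_cast; ring
  · obtain ⟨X, Y, hXY⟩ := exists_pair_ne_four_pow hn₂ hd₂ hn₃ hd₃ he₂ he₃ hp
    refine ⟨0, 2 ^ X, 2 ^ Y, Or.inr (Or.inl (h20 X)), fun k u v hu hv hv0 heq => ?_⟩
    refine hXY k u v hu hv (by exact_mod_cast hv0) ?_
    rw [← heq]; push_cast; ring


/-! ## Integral Gram–Schmidt steps and the "no three orthogonal vectors" corollary -/

/-- **One Gram–Schmidt step inside the lattice.** If `A(f,f) ≠ 0` then some non-zero integer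
multiple of `y` becomes `A`-orthogonal to `f` after subtracting an integer multiple of `f`.
[folklore] -/
theorem gramSchmidt_one {M : Type*} [AddCommGroup M] (A : M →+ M →+ ℚ) (f y : M)
    (hf : A f f ≠ 0) : ∃ c c₁ : ℤ, c ≠ 0 ∧ A f (c • y - c₁ • f) = 0 := by
  set ρ : ℚ := A f y / A f f with hρ
  refine ⟨ρ.den, ρ.num, by exact_mod_cast ρ.den_nz, ?_⟩
  have h1 : A f y = ρ * A f f := by rw [hρ]; field_simp
  simp only [map_sub, map_zsmul, zsmul_eq_mul, Int.cast_natCast]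
  rw [h1, ← mul_assoc, Rat.den_mul_eq_num]
  ring

/-- **Two Gram–Schmidt steps inside the lattice.** If `f₁, f₂` are `A`-orthogonal with
`A(fᵢ,fᵢ) ≠ 0`, then some non-zero integer multiple of `y` becomes `A`-orthogonal to both after
subtracting integer multiples of `f₁, f₂`. [folklore] -/
theorem gramSchmidt_two {M : Type*} [AddCommGroup M] (A : M →+ M →+ ℚ)
    (hsymm : ∀ x y, A x y = A y x) (f₁ f₂ y : M) (h₁ : A f₁ f₁ ≠ 0) (h₂ : A f₂ f₂ ≠ 0)
    (h₁₂ : A f₁ f₂ = 0) : ∃ C c₁ c₂ : ℤ, C ≠ 0 ∧ A f₁ (C • y - c₁ • f₁ - c₂ • f₂) = 0 ∧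
      A f₂ (C • y - c₁ • f₁ - c₂ • f₂) = 0 := by
  set ρ₁ : ℚ := A f₁ y / A f₁ f₁ with hρ₁
  set ρ₂ : ℚ := A f₂ y / A f₂ f₂ with hρ₂
  have h₂₁ : A f₂ f₁ = 0 := by rw [hsymm]; exact h₁₂
  have e₁ : A f₁ y = ρ₁ * A f₁ f₁ := by rw [hρ₁]; field_simp
  have e₂ : A f₂ y = ρ₂ * A f₂ f₂ := by rw [hρ₂]; field_simp
  refine ⟨ρ₁.den * ρ₂.den, ρ₁.num * ρ₂.den, ρ₂.num * ρ₁.den, ?_, ?_, ?_⟩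
  · exact mul_ne_zero (by exact_mod_cast ρ₁.den_nz) (by exact_mod_cast ρ₂.den_nz)
  · simp only [map_sub, map_zsmul, zsmul_eq_mul, h₁₂, mul_zero, sub_zero]
    push_cast
    rw [e₁]
    linear_combination ((ρ₂.den : ℚ) * A f₁ f₁) * Rat.den_mul_eq_num ρ₁
  · simp only [map_sub, map_zsmul, zsmul_eq_mul, h₂₁, mul_zero, sub_zero]
    push_cast
    rw [e₂]
    linear_combination ((ρ₁.den : ℚ) * A f₂ f₂) * Rat.den_mul_eq_num ρ₂

/-- Loeschian numbers are non-negative: `0 ≤ I² + IJ + J²`. [folklore] -/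
theorem loeschian_nonneg (I J : ℚ) : 0 ≤ I ^ 2 + I * J + J ^ 2 := by
  nlinarith [sq_nonneg (2 * I + J), sq_nonneg J]

/-- **No three orthogonal in-layer vectors.** Let `A` be a symmetric biadditive `ℚ`-valued form on
an abelian group all of whose diagonal values are in-layer template values `(I² + IJ + J²)/9`.
Then there are no three pairwise `A`-orthogonal elements with `A(fᵢ,fᵢ) > 0`: on
`ℤf₁ + ℤf₂ + ℤf₃` the form is diagonal and positive, so by the 2-adic obstruction it takes a value
which is not `4ᵏ · odd / 9`, whereas non-zero Loeschian numbers are `4ᵏ · odd`. [folklore] -/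
theorem no_three_orthogonal {M : Type*} [AddCommGroup M] (A : M →+ M →+ ℚ)
    (hsymm : ∀ x y, A x y = A y x)
    (hval : ∀ z, ∃ I J : ℤ, A z z = ((I : ℚ) ^ 2 + I * J + J ^ 2) / 9) {f₁ f₂ f₃ : M}
    (h₁₂ : A f₁ f₂ = 0) (h₁₃ : A f₁ f₃ = 0) (h₂₃ : A f₂ f₃ = 0)
    (h₁ : 0 < A f₁ f₁) (h₂ : 0 < A f₂ f₂) (h₃ : 0 < A f₃ f₃) : False := by
  obtain ⟨x, y, z, hne, hxyz⟩ := exists_ne_four_pow_mul_odd_div h₁ h₂ h₃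
  have h₂₁ : A f₂ f₁ = 0 := by rw [hsymm]; exact h₁₂
  have h₃₁ : A f₃ f₁ = 0 := by rw [hsymm]; exact h₁₃
  have h₃₂ : A f₃ f₂ = 0 := by rw [hsymm]; exact h₂₃
  set g : M := x • f₁ + y • f₂ + z • f₃ with hg
  have hAg : A g g = A f₁ f₁ * (x : ℚ) ^ 2 + A f₂ f₂ * (y : ℚ) ^ 2 + A f₃ f₃ * (z : ℚ) ^ 2 := by
    simp only [hg, map_add, map_zsmul, AddMonoidHom.add_apply, AddMonoidHom.zsmul_apply,
      zsmul_eq_mul, h₁₂, h₁₃, h₂₃, h₂₁, h₃₁, h₃₂]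
    ring
  obtain ⟨I, J, hIJ⟩ := hval g
  by_cases h0 : I = 0 ∧ J = 0
  · obtain ⟨rfl, rfl⟩ := h0
    have hzero : A g g = 0 := by rw [hIJ]; norm_num
    have hx2 : (0 : ℚ) ≤ (x : ℚ) ^ 2 := sq_nonneg _
    have hy2 : (0 : ℚ) ≤ (y : ℚ) ^ 2 := sq_nonneg _
    have hz2 : (0 : ℚ) ≤ (z : ℚ) ^ 2 := sq_nonneg _
    have hpos : 0 < A f₁ f₁ * (x : ℚ) ^ 2 + A f₂ f₂ * (y : ℚ) ^ 2 + A f₃ f₃ * (z : ℚ) ^ 2 := by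
      rcases hne with hx | hy | hz
      · have : (0 : ℚ) < (x : ℚ) ^ 2 := by positivity
        nlinarith [mul_pos h₁ this, mul_nonneg h₂.le hy2, mul_nonneg h₃.le hz2]
      · have : (0 : ℚ) < (y : ℚ) ^ 2 := by positivity
        nlinarith [mul_pos h₂ this, mul_nonneg h₁.le hx2, mul_nonneg h₃.le hz2]
      · have : (0 : ℚ) < (z : ℚ) ^ 2 := by positivity
        nlinarith [mul_pos h₃ this, mul_nonneg h₁.le hx2, mul_nonneg h₂.le hy2]
    rw [hAg] at hzero
    linarith
  · have hIJ' : I ≠ 0 ∨ J ≠ 0 := by tauto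
    obtain ⟨k, u, hu, hk⟩ := loeschian_eq_four_pow_mul_odd I J hIJ'
    refine hxyz k u 9 hu (by decide) (by norm_num) ?_
    rw [← hAg, hIJ]
    have hk' : ((I : ℚ) ^ 2 + I * J + J ^ 2) = 4 ^ k * u := by exact_mod_cast hk
    rw [hk']
    push_cast
    ring

end HcpRigiditySplit

/-- **Registered helper stub of `stub_templateLatticeSplit` (Aux file 2): the 2-adic
obstruction.** A diagonal ternary form with positive rational coefficients takes, at some non-zero
integer point, a value which is not of the form `4ᵏ u / v` with `u, v` odd. [folklore] -/
theorem stub_templateLatticeSplit_twoAdic : ∀ q₁ q₂ q₃ : ℚ, 0 < q₁ → 0 < q₂ → 0 < q₃ → ∃ x y z : ℤ, (x ≠ 0 ∨ y ≠ 0 ∨ z ≠ 0) ∧ ∀ (k : ℕ) (u v : ℤ), Odd u → Odd v → v ≠ 0 → q₁ * (x : ℚ) ^ 2 + q₂ * (y : ℚ) ^ 2 + q₃ * (z : ℚ) ^ 2 ≠ 4 ^ k * (u : ℚ) / (v : ℚ) :=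
  fun _ _ _ h₁ h₂ h₃ => HcpRigiditySplit.exists_ne_four_pow_mul_odd_div h₁ h₂ h₃

end Summit.AtomisticToContinuum.Crystallization.Theorems
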